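import Mathlib
import HarnessLib
import Summits.HubbardSuperconductivity.HubbardSuperconductivity.Theorems.KLProgrammeKLRegimeTwoVolumeBlockDefectResponse
import Literature.MathematicalPhysics.QuantumLattice.GrassmannDeepPinLipschitz

/-!
# Route `KLProgramme` — crux K3, the nested two-volume pass: ONE INDUCTIVE STEP at deep pins
# (interaction bracket `GrassmannDeepPinLipschitz` + covariance bracket `…TwoVolumeBlockDefectResponse`; cell gate-hubbard-kl, seat hubbard-kl-k3c4-p1 g7)

The step `n−1 → n` of the inductive comparison of the towers of two nested volumes on ONE Grassmann algebra (fine labels `Γ′ ≃ ι × Γ`, glued coarse objects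
`Σ_β map (Fe β) ·`): with `V` the coarse previous action (ONE-volume data), `W′` the fine previous action, `D := W′ − Glue V` SMALL AT DEEP PINS (pinned profile
`≤ E` on the deep region `Pd`, induction hypothesis) and merely bounded elsewhere (`φ(diam)`-weighted profile `N_D`), and `C′`/`C` the fine/coarse slice covariances,
`kernel (effAction C′ W′) − kernel (Glue (effAction C V))` at a pin `w` that is `Rd`-far from the complement of `Pd` AND `Rf`-far from the covariance zone `Zs` is bounded by
  [interaction bracket] `ρ′^{-(n+1)} e (‖E‖/(1−θ₁)² + φ(Rd)⁻¹ ‖N_D‖/(1−θ₂′)²)` (`Literature.…GrassmannDeepPinLipschitz.sum_norm_kernel_effAction_add_sub_le_of_deep`: support split +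
  homogeneous Lipschitz + zone bound) +
  [covariance bracket] the NEAR (response) + FAR bound of `sum_norm_kernel_sub_copies_le_response` (k3c5-p2 g6, p533565; far bracket/weights/copies/geometry from this seat's kit).
All inputs are ONE-volume numbers plus the induction hypothesis; iterating over the scales with depths `R_n = R_{n−1} + r_n` is the (A3) assembly of
`Cruxes`/evidence VL-STUB-ROUTE-A.md §4 (stub `stub_vl_nestedFramed` of 20440; (E3f-F) STEP(n ≥ 1) of 20437).

* **`sum_norm_kernel_twoVolume_step_le`** — the displayed bound.  Sorry-free; no definition.

References: BGM 2006 §2–§3 ((2.13)–(2.14), (2.77)–(2.90)); Salmhofer 1999 (2.102)–(2.106), §4.3; GK 1985 §3.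
-/

noncomputable section

namespace Summit.HubbardSuperconductivity.HubbardSuperconductivity.Theorems.TwoVolumeDefect

set_option linter.dupNamespace false -- summit = problem name (single-conjunct summit), D-0017

open Finset Literature.MathematicalPhysics.QuantumLattice GrassmannAlgebra Literature.Probability.LatticeModels
  Literature.Probability.LatticeModels.BattleFederbush
open scoped Nat InnerProductSpace

variable {𝕜 : Type*} [RCLike 𝕜]

/-- **ONE INDUCTIVE STEP OF THE NESTED TWO-VOLUME COMPARISON AT DEEP PINS** = interaction bracket (`sum_norm_kernel_effAction_add_sub_le_of_deep` on the fine
covariance `C′`, defect `W′ − Glue V` small on the deep region `Pd`, pin `Rd`-far from its complement) + covariance bracket (`sum_norm_kernel_sub_copies_le_response`,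
glued interaction `Glue V`, pin `Rf`-far from the zone `Zs`).  [folklore; BGM 2006 §2–§3; Salmhofer 1999 (2.102)–(2.106)] -/
theorem sum_norm_kernel_twoVolume_step_le {Γ ι : Type*} [Fintype Γ] [DecidableEq Γ] [Fintype ι] [DecidableEq ι]
    {Γ' : Type} [LinearOrder Γ'] [Fintype Γ']
    (e : Γ' ≃ ι × Γ) (C : Matrix Γ Γ 𝕜) (C' Ccop Dn Df : Matrix Γ' Γ' 𝕜) (Zs : Set Γ') [DecidablePred (· ∈ Zs)]
    (hCcop : ∀ X' Y', Ccop X' Y' = if (e X').1 = (e Y').1 then C (e X').2 (e Y').2 else 0)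
    (hDf : ∀ X' Y', Df X' Y' = if X' ∈ Zs ∧ Y' ∈ Zs then C' X' Y' - Ccop X' Y' else 0)
    (hDn : ∀ X' Y', Dn X' Y' = if X' ∈ Zs ∧ Y' ∈ Zs then 0 else C' X' Y' - Ccop X' Y')
    -- (P) periodisation, (G1)/(G2) geometry, row tail
    (hP : ∀ (X' : Γ') (Y : Γ), ∑ Y'' ∈ univ.filter (fun Y'' : Γ' => (e Y'').2 = Y), C' X' Y'' = C (e X').2 Y)
    (Far : Γ' → Γ' → Prop) [∀ X' Y', Decidable (Far X' Y')]
    (hG1 : ∀ X' Y', (e X').1 ≠ (e Y').1 → ¬ (X' ∈ Zs ∧ Y' ∈ Zs) → Far X' Y')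
    (hG2 : ∀ X' Y' Y'', (e X').1 = (e Y').1 → (e Y'').2 = (e Y').2 → Y'' ≠ Y' → ¬ (X' ∈ Zs ∧ Y' ∈ Zs) → Far X' Y'')
    {T : ℝ} (hT0 : 0 < T) (hT : ∀ X', ∑ Y' ∈ univ.filter (fun Y' : Γ' => Far X' Y'), ‖C' X' Y'‖ ≤ T)
    -- the ENTRY bound of the near defect (`norm_near_le_of_fibreTail` / `norm_near_le_of_sectional`)
    {Te : ℝ} (hTe : ∀ X' Y', ‖Dn X' Y'‖ ≤ Te)
    -- antisymmetry and decay numbers of `C`, `C′`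
    (hCt : ∀ X Y, C Y X = -C X Y) (hC't : ∀ X' Y', C' Y' X' = -C' X' Y')
    {s s' : ℝ} (hs0 : 0 ≤ s) (hs'0 : 0 ≤ s') (hs : ∀ X Y, ‖C X Y‖ ≤ s) (hs' : ∀ X' Y', ‖C' X' Y'‖ ≤ s')
    {α α' : ℝ} (hαα : 0 < α' + α) (hrow : ∀ X, ∑ Y, ‖C X Y‖ ≤ α) (hrow' : ∀ X', ∑ Y', ‖C' X' Y'‖ ≤ α')
    (dc : Γ → Γ → ℝ) (hdc : IsLabelDist dc) {m₁ m₁' : ℝ} (hm0 : 0 ≤ m₁) (hm0' : 0 ≤ m₁')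
    (hm1 : ∀ X, ∑ Y, ‖C X Y‖ * dc X Y ≤ m₁) (hm1' : ∀ X', ∑ Y', ‖C' X' Y'‖ * dc (e X').2 (e Y').2 ≤ m₁')
    -- Gram PROPERTIES of the two defects
    {κf : ℝ} (hκf : 0 < κf) (hGBf : ∀ t ∈ Set.Icc (0 : ℝ) 1, IsGramBoundedR (t • Df) κf)
    {κ₂ : ℝ} (hκ₂ : 0 < κ₂) (hGB2 : ∀ t ∈ Set.Icc (0 : ℝ) 1, IsGramBoundedR (Df + t • Dn) κ₂)
    -- the pin, far from the zone in the pulled-back coarse distance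
    {Rf : ℝ} (hRf : 0 < Rf) (w : Γ') (hdR : ∀ X, X ∈ Zs → Rf ≤ dc (e X).2 (e w).2)
    -- the coarse interaction and the block embeddings
    (Fe : ι → (Γ → 𝕜) →ₗ[𝕜] (Γ' → 𝕜)) (hFe : ∀ β v X', Fe β v X' = if (e X').1 = β then v (e X').2 else 0)
    {V : GrassmannAlgebra 𝕜 Γ} (hVe : V ∈ evenOdd 𝕜 0) (hV0 : constPart 𝕜 V = 0) (hZ : IsUnit (effPartitionFn 𝕜 C V))
    -- the coarse diameter-weighted all-degree profile and the two smallness conditions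
    (Nw : ℕ → ℝ) (hNw0 : ∀ m, 0 ≤ Nw m)
    (hNw : ∀ (m' : ℕ) (j : Fin (2 * m')) (x : Γ), ∑ Y ∈ univ.filter (fun Y : Fin (2 * m') → Γ => Y j = x),
      ‖kernel 𝕜 (effAction 𝕜 C V) (2 * m') Y‖ * (1 + labelDiam dc (univ.image Y)) ≤ Nw m')
    {ρf : ℝ} (hρf : 0 < ρf) (hθw : Real.exp 1 * (α' + α + (m₁' + m₁)) * normV Γ' κf ρf Nw / κf ^ 2 < 1)
    {ρ₂ : ℝ} (hρ₂ : 0 < ρ₂) (hθ₂ : Real.exp 1 * (α' + α + (m₁' + m₁)) * normV Γ' κ₂ ρ₂ Nw / κ₂ ^ 2 < 1)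
    -- the INTERACTION bracket: fine covariance Gram/weighted rows, the fine previous action `W′`, its defect against the glued `V`
    {κ' : ℝ} (hκ' : 0 < κ') (hGB' : IsGramBoundedR C' κ')
    (d' : Γ' → Γ' → ℝ) (hd' : IsLabelDist d') {phi : ℝ → ℝ} (hphi1 : ∀ s, 0 ≤ s → 1 ≤ phi s) (hphimono : ∀ s t, 0 ≤ s → s ≤ t → phi s ≤ phi t)
    (hphisub : ∀ s t, 0 ≤ s → 0 ≤ t → phi (s + t) ≤ phi s * phi t)
    (W' : GrassmannAlgebra 𝕜 Γ') (hW'e : W' ∈ evenPart 𝕜 Γ') (hW'0 : constPart 𝕜 W' = 0)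
    (NV ND E : ℕ → ℝ) (hNV0 : ∀ m', 0 ≤ NV m') (hND0 : ∀ m', 0 ≤ ND m') (hE0 : ∀ m', 0 ≤ E m')
    (hNV : ∀ m' (j : Fin (2 * m')) (x : Γ'), ∑ Y ∈ univ.filter (fun Y : Fin (2 * m') → Γ' => Y j = x),
      ‖kernel 𝕜 (∑ β, ExteriorAlgebra.map (Fe β) V) (2 * m') Y‖ * diamWeight phi d' (univ.image Y) ≤ NV m')
    (hND : ∀ m' (j : Fin (2 * m')) (x : Γ'), ∑ Y ∈ univ.filter (fun Y : Fin (2 * m') → Γ' => Y j = x),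
      ‖kernel 𝕜 (W' - ∑ β, ExteriorAlgebra.map (Fe β) V) (2 * m') Y‖ * diamWeight phi d' (univ.image Y) ≤ ND m')
    (Pd : Γ' → Prop) [DecidablePred Pd]
    (hE : ∀ m' (j : Fin (2 * m')) (x : Γ'), Pd x → ∑ Y ∈ univ.filter (fun Y : Fin (2 * m') → Γ' => Y j = x),
      ‖kernel 𝕜 (W' - ∑ β, ExteriorAlgebra.map (Fe β) V) (2 * m') Y‖ ≤ E m')
    {αw : ℝ} (hαw : 0 < αw) (hroww : ∀ X', ∑ Y', ‖C' X' Y'‖ * diamWeight phi d' {X', Y'} ≤ αw)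
    (hcolw : ∀ Y', ∑ X', ‖C' X' Y'‖ * diamWeight phi d' {X', Y'} ≤ αw) {ρ' : ℝ} (hρ' : 0 < ρ')
    (hθ₁ : Real.exp 1 * αw * (normV Γ' κ' ρ' (fun m' => NV m' + ND m') + normV Γ' κ' ρ' E) / κ' ^ 2 < 1)
    (hθ₂' : Real.exp 1 * αw * (normV Γ' κ' ρ' NV + normV Γ' κ' ρ' ND) / κ' ^ 2 < 1)
    {Rd : ℝ} (hRd : 0 ≤ Rd) (hwd : ∀ z, ¬ Pd z → Rd ≤ d' z w)
    (n : ℕ) (p : Fin (n + 1)) :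
    ∑ X ∈ univ.filter (fun X : Fin (n + 1) → Γ' => X p = w),
        ‖kernel 𝕜 (effAction 𝕜 C' W') (n + 1) X - kernel 𝕜 (∑ β, ExteriorAlgebra.map (Fe β) (effAction 𝕜 C V)) (n + 1) X‖ ≤
      (ρ'⁻¹ ^ (n + 1) * (Real.exp 1 * normV Γ' κ' ρ' E) /
            (1 - Real.exp 1 * αw * (normV Γ' κ' ρ' (fun m' => NV m' + ND m') + normV Γ' κ' ρ' E) / κ' ^ 2) ^ 2 +
          (phi Rd)⁻¹ * (ρ'⁻¹ ^ (n + 1) * (Real.exp 1 * normV Γ' κ' ρ' ND) /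
            (1 - Real.exp 1 * αw * (normV Γ' κ' ρ' NV + normV Γ' κ' ρ' ND) / κ' ^ 2) ^ 2)) +
      (
        ((((n + 1 + 1) * (n + 1 + 2) : ℕ) : ℝ) / 2 * Te * (ρ₂⁻¹ ^ (n + 3) * (Real.exp 1 * normV Γ' κ₂ ρ₂ Nw) / (1 - Real.exp 1 * (α' + α + (m₁' + m₁)) * normV Γ' κ₂ ρ₂ Nw / κ₂ ^ 2)) +
            ‖(2 : 𝕜)⁻¹‖ * ∑ a ∈ range (n + 2), ∑ b ∈ range (n + 2),
              (if a + b = n + 1 then (((a + 1) * (b + 1) : ℕ) : ℝ) *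
                (2 * T * (ρ₂⁻¹ ^ (a + 1) * (Real.exp 1 * normV Γ' κ₂ ρ₂ Nw) / (1 - Real.exp 1 * (α' + α + (m₁' + m₁)) * normV Γ' κ₂ ρ₂ Nw / κ₂ ^ 2)) * (ρ₂⁻¹ ^ (b + 1) * (Real.exp 1 * normV Γ' κ₂ ρ₂ Nw) / (1 - Real.exp 1 * (α' + α + (m₁' + m₁)) * normV Γ' κ₂ ρ₂ Nw / κ₂ ^ 2)) +
                  2 * T * (ρ₂⁻¹ ^ (a + 1) * (Real.exp 1 * normV Γ' κ₂ ρ₂ Nw) / (1 - Real.exp 1 * (α' + α + (m₁' + m₁)) * normV Γ' κ₂ ρ₂ Nw / κ₂ ^ 2)) * (ρ₂⁻¹ ^ (b + 1) * (Real.exp 1 * normV Γ' κ₂ ρ₂ Nw) / (1 - Real.exp 1 * (α' + α + (m₁' + m₁)) * normV Γ' κ₂ ρ₂ Nw / κ₂ ^ 2))) else 0)) +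
          ((((n + 1 + 1) * (n + 1 + 2) : ℕ) : ℝ) / 2 * ((s' + s) / Rf) *
              (ρf⁻¹ ^ (n + 3) * (Real.exp 1 * normV Γ' κf ρf Nw) /
                (1 - Real.exp 1 * (α' + α + (m₁' + m₁)) * normV Γ' κf ρf Nw / κf ^ 2)) +
            ‖(2 : 𝕜)⁻¹‖ * ∑ a ∈ range (n + 2), ∑ b ∈ range (n + 2),
              (if a + b = n + 1 then (((a + 1) * (b + 1) : ℕ) : ℝ) *
                ((α' + α) *
                    (ρf⁻¹ ^ (a + 1) * (Real.exp 1 * normV Γ' κf ρf Nw) /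
                        (1 - Real.exp 1 * (α' + α + (m₁' + m₁)) * normV Γ' κf ρf Nw / κf ^ 2) / Rf) *
                    (ρf⁻¹ ^ (b + 1) * (Real.exp 1 * normV Γ' κf ρf Nw) /
                      (1 - Real.exp 1 * (α' + α + (m₁' + m₁)) * normV Γ' κf ρf Nw / κf ^ 2)) +
                  (α' + α) *
                    (ρf⁻¹ ^ (a + 1) * (Real.exp 1 * normV Γ' κf ρf Nw) /
                      (1 - Real.exp 1 * (α' + α + (m₁' + m₁)) * normV Γ' κf ρf Nw / κf ^ 2)) *
                    (ρf⁻¹ ^ (b + 1) * (Real.exp 1 * normV Γ' κf ρf Nw) /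
                        (1 - Real.exp 1 * (α' + α + (m₁' + m₁)) * normV Γ' κf ρf Nw / κf ^ 2) / Rf)) else 0))
      ) := by
  -- the glued interaction and the defect
  have hV'e : (∑ β, ExteriorAlgebra.map (Fe β) V) ∈ evenPart 𝕜 Γ' :=
    (mem_evenPart_iff).2 (Submodule.sum_mem _ fun β _ => map_blockEmb_mem_evenOdd_zero hVe)
  have hV'0 : constPart 𝕜 (∑ β, ExteriorAlgebra.map (Fe β) V) = 0 := by
    rw [map_sum]; exact sum_eq_zero fun β _ => by rw [constPart_map, hV0]
  have hDe : W' - ∑ β, ExteriorAlgebra.map (Fe β) V ∈ evenPart 𝕜 Γ' := sub_mem hW'e hV'e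
  have hD0 : constPart 𝕜 (W' - ∑ β, ExteriorAlgebra.map (Fe β) V) = 0 := by rw [map_sub, hW'0, hV'0, sub_zero]
  -- the interaction bracket
  have hdeep := sum_norm_kernel_effAction_add_sub_le_of_deep C' hκ' hGB' d' hd' hphi1 hphimono hphisub (∑ β, ExteriorAlgebra.map (Fe β) V)
    (W' - ∑ β, ExteriorAlgebra.map (Fe β) V) hV'e hDe hV'0 hD0 NV ND E hNV0 hND0 hE0 hNV hND Pd hE hαw hroww hcolw hρ' hθ₁ hθ₂' w hRd hwd
    (Nat.succ_pos n) p
  have hW : (∑ β, ExteriorAlgebra.map (Fe β) V) + (W' - ∑ β, ExteriorAlgebra.map (Fe β) V) = W' := by abel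
  rw [hW] at hdeep
  -- the covariance bracket
  have hresp := sum_norm_kernel_sub_copies_le_response e C C' Ccop Dn Df Zs hCcop hDf hDn hP Far hG1 hG2 hT0 hT hTe hCt hC't hs0 hs'0 hs hs' hαα hrow hrow'
    dc hdc hm0 hm0' hm1 hm1' hκf hGBf hκ₂ hGB2 hRf w hdR Fe hFe hVe hV0 hZ Nw hNw0 hNw hρf hθw hρ₂ hθ₂ n p
  -- assemble
  calc ∑ X ∈ univ.filter (fun X : Fin (n + 1) → Γ' => X p = w),
        ‖kernel 𝕜 (effAction 𝕜 C' W') (n + 1) X - kernel 𝕜 (∑ β, ExteriorAlgebra.map (Fe β) (effAction 𝕜 C V)) (n + 1) X‖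
      ≤ ∑ X ∈ univ.filter (fun X : Fin (n + 1) → Γ' => X p = w),
          (‖kernel 𝕜 (effAction 𝕜 C' W') (n + 1) X - kernel 𝕜 (effAction 𝕜 C' (∑ β, ExteriorAlgebra.map (Fe β) V)) (n + 1) X‖ +
            ‖kernel 𝕜 (effAction 𝕜 C' (∑ β, ExteriorAlgebra.map (Fe β) V)) (n + 1) X -
              kernel 𝕜 (∑ β, ExteriorAlgebra.map (Fe β) (effAction 𝕜 C V)) (n + 1) X‖) :=
        sum_le_sum fun X _ => norm_sub_le_norm_sub_add_norm_sub _ _ _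
    _ ≤ _ := by rw [sum_add_distrib]; exact add_le_add hdeep hresp

end Summit.HubbardSuperconductivity.HubbardSuperconductivity.Theorems.TwoVolumeDefect

end
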